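import Summits.QuantumFields.BalabanUV.T4Continuum.Support.ShellMeasureWindowFixedCentre

/-!
# `T4Continuum.ShellMeasureWindowFixedCentreWiring` — the fixed-centre (LR)_j END made DROP-IN: the block's window
# read in the chart about the fixed centre is a centre-monotone co-test of the chart point, the exterior window rides
# as a section constant, and the dictionary is asked of the REST of the density only
# (cell `pub-balaban`, sub-cell `t4`, spine estimate NE7c (node U5b); NE7c ROUND-2 crew `t4-ne7c-formalise-*`, seat
# leaf-10 (gen 2), file 2 of the OFFERED row «(LR)_j with print's fixed centre» (journal l.7391 / l.7552); ADDITIVE —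
# imports `ShellMeasureWindowFixedCentre` (p210846) only, modifies nothing)

HONEST FRAMING.  Finite four-torus programme, rung (B)+1 only — NOT infinite volume, NOT a mass gap, NOT the Clay
problem, NOT summit progress; (B), `BetaPertHyp`, (B^μ) are not consumed.  (M1) for Bałaban's inductively defined
effective measures is NOT PRINTED (GAPS G-ne7cp1-1), asserted by nobody, NOT moved here.  NE7c ⇐ the named binders
(trigger c3); NE7c NOT PRINTED, NOT proved; spine PROVED 0/9 before and after.  STRUCTURAL BOOKKEEPING — no estimate,
0 sorry, 0 citations, no `def` (c2).  HONEST DEPENDENCY (cell): continuum YM on T⁴ ⇐ BetaPertH ∧ nine spine estimates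
(0/9 proved); BetaPertH ⇐ (D1) ∧ (D4) ∧ CAP+tail; G-an2-4 gates asym, D1 and NE2/3/4.

THE POINT.  `ShellMeasureWindowFixedCentre.slotAC_realized_su2_of_levelData_ballWindow_fixedCentre` (file 1 §3) proves
(M1) for the realized law `(fieldMeasure P j SU2).withDensity (1[∀ b ∈ B_w, dist1 ((c₀ b)⁻¹ U b) ≤ τ] · G)` (print's
window (1.27) about the FIXED centre (1.26), `G` the rest of the gauge-fixed density) from the level data, asking the
dictionary `hFdict` of the WHOLE density and leaving the kept co-tests `Jco` abstract.  Here the window's own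
contribution is computed once and for all:
* §1 `ballWindow_updateFinset_iff` — at a raw section `V[Λ := y]` the window over `B_w ⊇ Λ` SPLITS into the block
  part (a condition on `y` alone) and the exterior part over `B_w ∖ Λ` (a condition on `V` alone);
  `ballWindow_chart_iff` — read in the chart about `c₀` the block part is `∀ b, dist1 (exp(ι x_b)) ≤ τ`
  (`ShellMeasureWindowBall.dist1_inv_mul_chart`); `indicator_ballWindow_chart` — the indicator as a product;
  `fdict_of_gdict` — file 1's dictionary `hFdict` from a dictionary of the REST of the density.
* §2 `ballIndLe_le_smul` — the CLOSED-ball block co-test times the cube indicator is centre-monotone along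
  `x ↦ e^{−a}x` (closed twin of `ShellMeasureWindowBall.ballInd_le_smul`; no smallness beyond `3S² < π²`).
* §3 `slotAC_realized_su2_of_levelData_ballWindow_fixedCentre_wired` — file 1 §3 with
  `Jco V x := 1[x ∈ cube ∧ block window at x] · 1[exterior window at V] · Jrest V x`: the binders `hJW`/`hJ` are asked
  of `Jrest` only, and the dictionary `hGdict` is asked of `G` only, and only where both windows hold.  Conclusion
  LITERALLY file 1's / E2′'s.
WHAT THIS DOES NOT DO.  No instance of SM-L1/L3/L4/L6 at any `j ≥ 1`; (M1) per slot stays THE wall; NE7c NOT proved.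
-/

noncomputable section

open NormedSpace Set Function MeasureTheory Metric

namespace Summit.QuantumFields.BalabanUV.T4Continuum.ShellMeasureWindowFixedCentreWiring

open scoped ENNReal
open Literature.MathematicalPhysics.QuantumFieldTheory.Balaban1983to89
open T4ShellMeasure (SlotAntiConcentration)
open T4CubePoincare (cube)
open T4CubeChartGnomonic (SU2)
open T4CubeChartExp (expPt expFibreChart)
open T4ShellMeasureDet (blockLaw)
open T4TiltOscillation (updateFinset_apply_of_mem updateFinset_apply_of_not_mem)
open ShellMeasureScalingSU2 (smul_mem_cube)
open ShellMeasureWilsonTrace (TraceData)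
open ShellMeasureWilsonMoving (MLetter mwordEval mdFro sSum lSum)
open ShellMeasureLevelAssembly (classifier weight)
open ShellMeasureWindowBall (dist1_inv_mul_chart dist1_chart_smul_le)
open ShellMeasureWindowFixedCentre (slotAC_realized_su2_of_levelData_ballWindow_fixedCentre)

variable {P : Params} {j : ℕ} [DecidableEq (PBond P j)]
variable {A : Type*} [NormedRing A] [NormedAlgebra ℂ A] [CompleteSpace A] [NormOneClass A]

/-! ## §1 The window at a raw section splits: block part (on `y`) × exterior part (on `V`) -/

/-- **SPLIT OF THE WINDOW AT A RAW SECTION.**  For `Λ ⊆ B_w`: the window condition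
`∀ b ∈ B_w, dist1 ((c₀ b)⁻¹ · V[Λ := y] b) ≤ τ` at a raw section holds iff the BLOCK PART holds for `y`
(`∀ b ∈ Λ, dist1 ((c₀ b)⁻¹ y_b) ≤ τ`) and the EXTERIOR PART holds for `V` (`∀ b ∈ B_w ∖ Λ, dist1 ((c₀ b)⁻¹ V b) ≤ τ`).
[folklore] -/
theorem ballWindow_updateFinset_iff {Bw Λ : Finset (PBond P j)} (hΛ : Λ ⊆ Bw) (c₀ : GaugeField P j SU2) (τ : ℝ)
    (V : GaugeField P j SU2) (y : ↥Λ → SU2) :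
    (∀ b ∈ Bw, dist1 ((c₀ b)⁻¹ * updateFinset V Λ y b) ≤ τ) ↔
      (∀ b (hb : b ∈ Λ), dist1 ((c₀ b)⁻¹ * y ⟨b, hb⟩) ≤ τ) ∧
        ∀ b ∈ Bw, b ∉ Λ → dist1 ((c₀ b)⁻¹ * V b) ≤ τ := by
  constructor
  · intro h
    refine ⟨fun b hb => ?_, fun b hbw hbΛ => ?_⟩
    · have h' := h b (hΛ hb)
      rwa [updateFinset_apply_of_mem _ _ hb] at h'
    · have h' := h b hbw
      rwa [updateFinset_apply_of_not_mem _ _ hbΛ] at h'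
  · rintro ⟨hy, hV⟩ b hbw
    by_cases hbΛ : b ∈ Λ
    · rw [updateFinset_apply_of_mem _ _ hbΛ]; exact hy b hbΛ
    · rw [updateFinset_apply_of_not_mem _ _ hbΛ]; exact hV b hbw hbΛ

omit [DecidableEq (PBond P j)] in
/-- **THE BLOCK PART READ IN THE CHART ABOUT THE FIXED CENTRE**: at `y = κ_{c₀}(x)` the block part is
`∀ b, dist1 (exp(ι x_b)) ≤ τ` — a condition on the chart point only (`ShellMeasureWindowBall.dist1_inv_mul_chart`).
[folklore] -/
theorem ballWindow_chart_iff (Λ : Finset (PBond P j)) {n : ℕ} (e : ↥Λ × Fin 3 ≃ Fin n) (c₀ : GaugeField P j SU2)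
    (τ : ℝ) (x : Fin n → ℝ) :
    (∀ b (hb : b ∈ Λ), dist1 ((c₀ b)⁻¹ * expFibreChart Λ c₀ e x ⟨b, hb⟩) ≤ τ) ↔
      ∀ b : ↥Λ, dist1 (expPt fun i => x (e (b, i))) ≤ τ := by
  constructor
  · intro h b; rw [← dist1_inv_mul_chart Λ e c₀ x b]; exact h b.1 b.2
  · intro h b hb; rw [dist1_inv_mul_chart Λ e c₀ x ⟨b, hb⟩]; exact h ⟨b, hb⟩

/-- **THE WINDOW INDICATOR AT A CHART SECTION IS A PRODUCT**: block co-test of the chart point × exterior window of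
`V`. [folklore] -/
theorem indicator_ballWindow_chart {Bw Λ : Finset (PBond P j)} (hΛ : Λ ⊆ Bw) {n : ℕ} (e : ↥Λ × Fin 3 ≃ Fin n)
    (c₀ : GaugeField P j SU2) (τ : ℝ) (V : GaugeField P j SU2) (x : Fin n → ℝ) :
    {U : GaugeField P j SU2 | ∀ b ∈ Bw, dist1 ((c₀ b)⁻¹ * U b) ≤ τ}.indicator (1 : GaugeField P j SU2 → ℝ≥0∞)
        (updateFinset V Λ (expFibreChart Λ c₀ e x)) =
      {x : Fin n → ℝ | ∀ b : ↥Λ, dist1 (expPt fun i => x (e (b, i))) ≤ τ}.indicator (1 : (Fin n → ℝ) → ℝ≥0∞) x *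
        {V : GaugeField P j SU2 | ∀ b ∈ Bw, b ∉ Λ → dist1 ((c₀ b)⁻¹ * V b) ≤ τ}.indicator
          (1 : GaugeField P j SU2 → ℝ≥0∞) V := by
  -- the window condition at the chart section ⇔ block part (on `x`) ∧ exterior part (on `V`)
  have hiff : (∀ b ∈ Bw, dist1 ((c₀ b)⁻¹ * updateFinset V Λ (expFibreChart Λ c₀ e x) b) ≤ τ) ↔
      (∀ b : ↥Λ, dist1 (expPt fun i => x (e (b, i))) ≤ τ) ∧ ∀ b ∈ Bw, b ∉ Λ → dist1 ((c₀ b)⁻¹ * V b) ≤ τ :=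
    (ballWindow_updateFinset_iff hΛ c₀ τ V (expFibreChart Λ c₀ e x)).trans
      (and_congr_left' (ballWindow_chart_iff Λ e c₀ τ x))
  by_cases hx : x ∈ {x : Fin n → ℝ | ∀ b : ↥Λ, dist1 (expPt fun i => x (e (b, i))) ≤ τ}
  · by_cases hV : V ∈ {V : GaugeField P j SU2 | ∀ b ∈ Bw, b ∉ Λ → dist1 ((c₀ b)⁻¹ * V b) ≤ τ}
    · rw [indicator_of_mem hx, indicator_of_mem hV]
      exact (indicator_of_mem
        (show updateFinset V Λ (expFibreChart Λ c₀ e x) ∈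
          {U : GaugeField P j SU2 | ∀ b ∈ Bw, dist1 ((c₀ b)⁻¹ * U b) ≤ τ} from hiff.2 ⟨hx, hV⟩) _).trans
        (by simp only [Pi.one_apply, mul_one]; rfl)
    · rw [indicator_of_notMem hV, mul_zero]
      exact indicator_of_notMem
        (show updateFinset V Λ (expFibreChart Λ c₀ e x) ∉
          {U : GaugeField P j SU2 | ∀ b ∈ Bw, dist1 ((c₀ b)⁻¹ * U b) ≤ τ} from fun h => hV (hiff.1 h).2) _
  · rw [indicator_of_notMem hx, zero_mul]
    exact indicator_of_notMem
      (show updateFinset V Λ (expFibreChart Λ c₀ e x) ∉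
        {U : GaugeField P j SU2 | ∀ b ∈ Bw, dist1 ((c₀ b)⁻¹ * U b) ≤ τ} from fun h => hx (hiff.1 h).1) _

/-- **HENCE THE DICTIONARY OF THE WHOLE DENSITY FROM THE DICTIONARY OF THE REST.**  If, where the exterior window holds
at `V` and the block window holds at the cube point `x`, `G (V[Λ := κ_{c₀}(x)]) = Jrest V x · w V x`, then at EVERY cube
point `1[window](V[Λ := κ_{c₀}(x)]) · G (V[Λ := κ_{c₀}(x)]) = (1[x ∈ cube ∧ block window] · (1[exterior window at V] ·
Jrest V x)) · w V x` — file 1 §3's `hFdict` for the wired co-tests. [folklore] -/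
theorem fdict_of_gdict {Bw Λ : Finset (PBond P j)} (hΛ : Λ ⊆ Bw) {n : ℕ} (e : ↥Λ × Fin 3 ≃ Fin n)
    (c₀ : GaugeField P j SU2) (τ S : ℝ) {G : GaugeField P j SU2 → ℝ≥0∞}
    {Jrest w : GaugeField P j SU2 → (Fin n → ℝ) → ℝ≥0∞}
    (hGdict : ∀ V, (∀ b ∈ Bw, b ∉ Λ → dist1 ((c₀ b)⁻¹ * V b) ≤ τ) → ∀ x ∈ cube n S,
      (∀ b : ↥Λ, dist1 (expPt fun i => x (e (b, i))) ≤ τ) →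
      G (updateFinset V Λ (expFibreChart Λ c₀ e x)) = Jrest V x * w V x)
    (V : GaugeField P j SU2) {x : Fin n → ℝ} (hx : x ∈ cube n S) :
    {U : GaugeField P j SU2 | ∀ b ∈ Bw, dist1 ((c₀ b)⁻¹ * U b) ≤ τ}.indicator (1 : GaugeField P j SU2 → ℝ≥0∞)
          (updateFinset V Λ (expFibreChart Λ c₀ e x)) * G (updateFinset V Λ (expFibreChart Λ c₀ e x)) =
      {x : Fin n → ℝ | x ∈ cube n S ∧ ∀ b : ↥Λ, dist1 (expPt fun i => x (e (b, i))) ≤ τ}.indicator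
          (1 : (Fin n → ℝ) → ℝ≥0∞) x *
        ({V : GaugeField P j SU2 | ∀ b ∈ Bw, b ∉ Λ → dist1 ((c₀ b)⁻¹ * V b) ≤ τ}.indicator
          (1 : GaugeField P j SU2 → ℝ≥0∞) V * Jrest V x) * w V x := by
  rw [indicator_ballWindow_chart hΛ e c₀ τ V x]
  by_cases hxw : x ∈ {x : Fin n → ℝ | ∀ b : ↥Λ, dist1 (expPt fun i => x (e (b, i))) ≤ τ}
  · have hxc : x ∈ {x : Fin n → ℝ | x ∈ cube n S ∧ ∀ b : ↥Λ, dist1 (expPt fun i => x (e (b, i))) ≤ τ} := ⟨hx, hxw⟩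
    by_cases hV : V ∈ {V : GaugeField P j SU2 | ∀ b ∈ Bw, b ∉ Λ → dist1 ((c₀ b)⁻¹ * V b) ≤ τ}
    · rw [indicator_of_mem hxw, indicator_of_mem hV, indicator_of_mem hxc, hGdict V hV x hx hxw]
      simp only [Pi.one_apply, one_mul]
    · rw [indicator_of_notMem hV]
      simp only [mul_zero, zero_mul]
  · have hxc : x ∉ {x : Fin n → ℝ | x ∈ cube n S ∧ ∀ b : ↥Λ, dist1 (expPt fun i => x (e (b, i))) ≤ τ} :=
      fun h => hxw h.2
    rw [indicator_of_notMem hxw, indicator_of_notMem hxc]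
    simp only [zero_mul]

/-! ## §2 The closed-ball block co-test (times the cube indicator) is centre-monotone -/

omit [DecidableEq (PBond P j)] in
/-- **THE CLOSED-BALL BLOCK CO-TEST IS CENTRE-MONOTONE** along `x ↦ e^{−a}x`, `a ≥ 0`, at every chart point:
`1[x ∈ cube ∧ ∀ b, dist1 (exp(ι x_b)) ≤ τ] ≤` the same at `e^{−a}•x` (`ShellMeasureWindowBall.dist1_chart_smul_le`: on
the cube, `3S² < π²`, the bond deviation `2|sin(‖x_b‖/2)|` does not increase towards the centre; closed twin of
`ShellMeasureWindowBall.ballInd_le_smul`) — the `hJ` of the window's block part in END-II. [folklore] -/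
theorem ballIndLe_le_smul (Λ : Finset (PBond P j)) {n : ℕ} (e : ↥Λ × Fin 3 ≃ Fin n) (c₀ : GaugeField P j SU2)
    {S : ℝ} (hSπ : 3 * S ^ 2 < Real.pi ^ 2) (τ : ℝ) (x : Fin n → ℝ) {a : ℝ} (ha : 0 ≤ a) :
    {x : Fin n → ℝ | x ∈ cube n S ∧ ∀ b : ↥Λ, dist1 (expPt fun i => x (e (b, i))) ≤ τ}.indicator
        (1 : (Fin n → ℝ) → ℝ≥0∞) x ≤
      {x : Fin n → ℝ | x ∈ cube n S ∧ ∀ b : ↥Λ, dist1 (expPt fun i => x (e (b, i))) ≤ τ}.indicator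
        (1 : (Fin n → ℝ) → ℝ≥0∞) (Real.exp (-a) • x) := by
  by_cases hx : x ∈ {x : Fin n → ℝ | x ∈ cube n S ∧ ∀ b : ↥Λ, dist1 (expPt fun i => x (e (b, i))) ≤ τ}
  · have hc0 : 0 ≤ Real.exp (-a) := (Real.exp_pos _).le
    have hc1 : Real.exp (-a) ≤ 1 := by rw [Real.exp_le_one_iff]; linarith
    have hx' : Real.exp (-a) • x ∈
        {x : Fin n → ℝ | x ∈ cube n S ∧ ∀ b : ↥Λ, dist1 (expPt fun i => x (e (b, i))) ≤ τ} := by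
      refine ⟨smul_mem_cube hx.1 hc0 hc1, fun b => ?_⟩
      have h := dist1_chart_smul_le Λ e c₀ hSπ hx.1 hc0 hc1 b
      rw [dist1_inv_mul_chart, dist1_inv_mul_chart] at h
      exact h.trans (hx.2 b)
    rw [indicator_of_mem hx, indicator_of_mem hx']
    simp only [Pi.one_apply, le_refl]
  · rw [indicator_of_notMem hx]
    exact bot_le

/-! ## §3 The fixed-centre END, wired: co-tests and dictionary asked of the REST of the density only -/

/-- **END-II, FIXED-CENTRE BALL WINDOW, WIRED (`G = SU(2)`).**  File 1 §3
(`ShellMeasureWindowFixedCentre.slotAC_realized_su2_of_levelData_ballWindow_fixedCentre`: realized density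
`F = 1[∀ b ∈ B_w, dist1 ((c₀ b)⁻¹ U b) ≤ τ] · G`, `Λ ⊆ B_w`, `τ ≤ 2 sin(S/2)`, measurable `G`, `u`, per-section
finiteness, level data `hol Gw 𝓔 W` with SM-L1 `hAN`, SM-L3 `hGW` + sizes, SM-L4 `hE`, numbers, SM-L2 `hSM`) with the kept
co-tests INSTANTIATED as `Jco V x := 1[x ∈ cube ∧ ∀ b, dist1 (exp(ι x_b)) ≤ τ] · 1[∀ b ∈ B_w ∖ Λ, dist1 ((c₀ b)⁻¹ V b) ≤ τ]
· Jrest V x`: the binders SM-L5/L6 `hJW`/`hJ` are asked of the REMAINING co-tests `Jrest` only (§2 supplies the window's),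
and the dictionary is asked of `G` only and only where both window parts hold —
`hGdict : ∀ V, (∀ b ∈ B_w ∖ Λ, dist1 ((c₀ b)⁻¹ V b) ≤ τ) → ∀ x ∈ cube, (∀ b, dist1 (exp(ι x_b)) ≤ τ) →
G (V[Λ := κ_{c₀}(x)]) = Jrest V x · weight Ttr β P_w (Gw V) (𝓔 V) x`; `hudict` as in file 1.  CONCLUSION (E2′'s):
`SlotAntiConcentration ((fieldMeasure P j SU2).withDensity F) u θ ρ (2(n + βΣ_p L̄_p(d̄_p + 4s̄_p) + B_𝓔)/(1−δ))`.
CONDITIONAL on every displayed binder; nothing PRINTED is asserted. [folklore] -/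
theorem slotAC_realized_su2_of_levelData_ballWindow_fixedCentre_wired {Bw Λ : Finset (PBond P j)} (hΛ : Λ ⊆ Bw)
    (c₀ : GaugeField P j SU2) {τ : ℝ} {n : ℕ} (e : ↥Λ × Fin 3 ≃ Fin n)
    {S : ℝ} (hS : 0 < S) (hSπ : 3 * S ^ 2 < Real.pi ^ 2) (hτ : τ ≤ 2 * Real.sin (S / 2))
    {G : GaugeField P j SU2 → ℝ≥0∞} (hG : Measurable G)
    (hfin : ∀ V, ((blockLaw Λ).withDensity fun y =>
      {U : GaugeField P j SU2 | ∀ b ∈ Bw, dist1 ((c₀ b)⁻¹ * U b) ≤ τ}.indicator (1 : GaugeField P j SU2 → ℝ≥0∞)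
        (updateFinset V Λ y) * G (updateFinset V Λ y)) univ ≠ ∞)
    {u : GaugeField P j SU2 → ℝ} (hu : Measurable u)
    -- level data per exterior section (E2′'s, verbatim)
    (Ttr : TraceData A) (hN : 0 < Ttr.N) {ι κ : Type*} {Pu : Finset ι} (hPu : Pu.Nonempty)
    (hol : GaugeField P j SU2 → ι → (Fin n → ℝ) → A) (hcont : ∀ V, ∀ p ∈ Pu, Continuous (hol V p))
    (Pw : Finset κ) (Gw : GaugeField P j SU2 → κ → (Fin n → ℝ) → A) (𝓔 : GaugeField P j SU2 → (Fin n → ℝ) → ℝ)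
    (W : GaugeField P j SU2 → Set (Fin n → ℝ)) (Jrest : GaugeField P j SU2 → (Fin n → ℝ) → ℝ≥0∞)
    {θ δ ρ β Rad H B𝓔 : ℝ} {sw lw dw : κ → ℝ}
    -- DICTIONARY of the REST of the density, where both window parts hold, on the chart cube only
    (hGdict : ∀ V, (∀ b ∈ Bw, b ∉ Λ → dist1 ((c₀ b)⁻¹ * V b) ≤ τ) → ∀ x ∈ cube n S,
      (∀ b : ↥Λ, dist1 (expPt fun i => x (e (b, i))) ≤ τ) →
      G (updateFinset V Λ (expFibreChart Λ c₀ e x)) = Jrest V x * weight Ttr β Pw (Gw V) (𝓔 V) x)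
    (hudict : ∀ V, ∀ x ∈ cube n S,
      u (updateFinset V Λ (expFibreChart Λ c₀ e x)) = classifier hPu (hol V) x)
    -- SM-L5/L6 for the REMAINING kept co-tests
    (hJW : ∀ V x, Jrest V x ≠ 0 → x ∈ W V)
    (hJ : ∀ V x, ∀ a : ℝ, 0 ≤ a → Jrest V x ≤ Jrest V (Real.exp (-a) • x))
    -- SM-L1 (AN-bound)
    (hRad : 1 < Rad)
    (hAN : ∀ V, ∀ x ∈ W V, ∀ p ∈ Pu, ∃ f : ℂ → A, DifferentiableOn ℂ f (ball 0 Rad) ∧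
      (∀ w ∈ ball (0 : ℂ) Rad, ‖f w‖ ≤ H) ∧ f 0 = 0 ∧ ∀ c' : ℝ, 0 ≤ c' → c' ≤ 1 → f (c' : ℂ) = hol V p (c' • x) - 1)
    -- SM-L3 graded sectioned words
    (hGW : ∀ V, ∀ x ∈ W V, ∀ p ∈ Pw, ∃ gw : List (MLetter A × ℝ × ℝ), (∀ y ∈ gw, y.1.Good Ttr.τ y.2.1 y.2.2) ∧
      sSum gw ≤ sw p ∧ lSum gw ≤ lw p ∧ mdFro (gw.map Prod.fst) ≤ dw p ∧
      ∀ c' : ℝ, 0 ≤ c' → c' ≤ 1 → mwordEval c' (gw.map Prod.fst) = Gw V p (c' • x))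
    (hsw1 : ∀ p ∈ Pw, sw p ≤ 1) (hsw0 : ∀ p ∈ Pw, 0 ≤ sw p) (hlw0 : ∀ p ∈ Pw, 0 ≤ lw p)
    (hdw0 : ∀ p ∈ Pw, 0 ≤ dw p)
    -- SM-L4 non-Wilson ray bound
    (hE : ∀ V, ∀ x ∈ W V, ∀ c' : ℝ, 1 / 2 ≤ c' → c' ≤ 1 → 𝓔 V (c' • x) ≤ 𝓔 V x + (1 - c') * B𝓔) (hB𝓔 : 0 ≤ B𝓔)
    -- numbers + SM-L2 (SM)
    (hθ : 0 < θ) (hδ0 : 0 ≤ δ) (hδ1 : δ < 1) (hρ0 : 0 ≤ ρ) (hρ : ρ ≤ (1 - δ) / 2) (hβ : 0 ≤ β)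
    (hSM : 36 * H * 1 ^ 2 / (Rad - 1) ^ 2 ≤ δ * θ) :
    SlotAntiConcentration ((fieldMeasure P j SU2).withDensity fun U =>
        {U : GaugeField P j SU2 | ∀ b ∈ Bw, dist1 ((c₀ b)⁻¹ * U b) ≤ τ}.indicator (1 : GaugeField P j SU2 → ℝ≥0∞) U *
          G U) u θ ρ
      (2 * ((n : ℝ) + (β * ∑ p ∈ Pw, lw p * (dw p + 4 * sw p) + B𝓔)) / (1 - δ)) :=
  -- the kept co-tests: (cube ∧ block window at x) · (exterior window at V) · Jrest
  slotAC_realized_su2_of_levelData_ballWindow_fixedCentre hΛ c₀ e hS hSπ hτ hG hfin hu Ttr hN hPu hol hcont Pw Gw 𝓔 W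
    (fun V x => {x : Fin n → ℝ | x ∈ cube n S ∧ ∀ b : ↥Λ, dist1 (expPt fun i => x (e (b, i))) ≤ τ}.indicator
        (1 : (Fin n → ℝ) → ℝ≥0∞) x *
      ({V : GaugeField P j SU2 | ∀ b ∈ Bw, b ∉ Λ → dist1 ((c₀ b)⁻¹ * V b) ≤ τ}.indicator
        (1 : GaugeField P j SU2 → ℝ≥0∞) V * Jrest V x))
    (fun V _ hx => fdict_of_gdict hΛ e c₀ τ S hGdict V hx) hudict
    (fun V x hne => hJW V x (right_ne_zero_of_mul (right_ne_zero_of_mul hne)))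
    (fun V x a ha => mul_le_mul' (ballIndLe_le_smul Λ e c₀ hSπ τ x ha) (mul_le_mul' le_rfl (hJ V x a ha)))
    hRad hAN hGW hsw1 hsw0 hlw0 hdw0 hE hB𝓔 hθ hδ0 hδ1 hρ0 hρ hβ hSM

end Summit.QuantumFields.BalabanUV.T4Continuum.ShellMeasureWindowFixedCentreWiring

end
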